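import Summits.BirchSwinnertonDyer.Rank1Residual.X11b.KummerTwistIntersectionPadic
import Mathlib.NumberTheory.Padics.HeightOneSpectrum
import HarnessLib

/-!
# `μ_p(ℚ_p) = 1` for an odd prime `p`, at the place of `ℚ` above `p`
# (class X11b, cell `b2b-bsdres`, unit `b2b-bsdres-sha-2`, gen 27; part (e3) of the instrument)

HONEST FRAMING (run/shared/lean/b2b/bsd-rank1-residual/, verbatim in every file): prove what is
provable now; shrink each hard class to its core with data; no claim beyond stated classes. THEOREMS
ONLY — no new definition, no named fact, no `sorry`; elementary; nothing about any curve; nothing here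
moves a census label.

## What this file proves and why

The tree's one-directional local lemmas for two potentially multiplicative curves with isomorphic
`p`-torsion (`TwistedKummer.h1Equiv_mem_selmerLocalKer_of_one_lt_valuation_j`,
`h1Equiv_mem_selmerLocalKer_of_hasMultiplicativeReductionAt`) carry the hypothesis
`hμ : ∀ ζ : K_v, ζ ^ p = 1 → ζ = 1` ("`μ_p(K_v) = 1`"). Away from `p` the tree decides it
(`adicCompletion_pow_eq_one_imp`: `q_v ≢ 1 mod p`); at `p = 3` above `3` it decides it by the square
class of `-3` (`LocalTorsion3At.forall_pow_three_eq_one_adicCompletion_of_sqFlagAt`). This file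
supplies the remaining case used by the `v ∣ p` rows of the congruent-curve transfer (unit sha-2,
rule V22/V23 typing): for EVERY odd prime `p`, `μ_p(ℚ_p) = 1` — a primitive `p`-th root of unity
`ζ ∈ ℂ_p` has `‖ζ − 1‖ = p^{−1/(p−1)} ∉ p^ℤ` (`R1.norm_sub_one_ne_zpow`, gen 24), while every
non-zero element of `ℚ_p ⊆ ℂ_p` has norm in `p^ℤ`; transported to Mathlib's `v.adicCompletion ℚ`
along `Rat.HeightOneSpectrum.adicCompletion.padicEquiv`.

References: J. W. S. Cassels, *Local Fields*, Ch. 6 (`ℚ_p(ζ_p)/ℚ_p` totally ramified of degree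
`p − 1`) [Cassels1986]; J.-P. Serre, *A Course in Arithmetic*, Ch. II §3.3 [Serre1973].
-/

set_option autoImplicit false

noncomputable section

open scoped Classical

open NumberField IsDedekindDomain Rat.HeightOneSpectrum

namespace Summit.BirchSwinnertonDyer.Rank1Residual.X11b.CongruentTransfer

variable {p : ℕ} [hp : Fact p.Prime]

/-- **`μ_p(ℚ_p) = 1` for `p` odd**: `ζ ∈ ℚ_p`, `ζ^p = 1 ⟹ ζ = 1`. (Every non-zero element of
`ℚ_p ⊆ ℂ_p` has norm in `p^ℤ`, and a primitive `p`-th root of unity `ζ` would give `‖ζ − 1‖ =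
p^{−1/(p−1)}`, not in `p^ℤ` for `p ≠ 2`: `R1.pow_eq_one_imp_eq_one_of_norm_zpow`.)
[cite: Cassels1986, Ch. 6] -/
theorem padic_pow_eq_one_imp_eq_one (hp2 : p ≠ 2) : ∀ ζ : ℚ_[p], ζ ^ p = 1 → ζ = 1 := by
  intro ζ hζ
  have hL : ∀ w ∈ (algebraMap ℚ_[p] ℂ_[p]).fieldRange, w ≠ 0 → ∃ n : ℤ, ‖w‖ = (p : ℝ) ^ n := by
    intro w hw hw0
    obtain ⟨x, rfl⟩ := RingHom.mem_fieldRange.mp hw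
    have hx : x ≠ 0 := fun h => hw0 (by rw [h, map_zero])
    exact ⟨-x.valuation, (PadicComplex.norm_extends' (p := p) x).trans
      (Padic.norm_eq_zpow_neg_valuation hx)⟩
  have h1 : algebraMap ℚ_[p] ℂ_[p] ζ = 1 :=
    R1.pow_eq_one_imp_eq_one_of_norm_zpow hp2 _ hL _ (RingHom.mem_fieldRange.mpr ⟨ζ, rfl⟩)
      (by rw [← map_pow, hζ, map_one])
  exact (algebraMap ℚ_[p] ℂ_[p]).injective (h1.trans (map_one _).symm)

/-- **`μ_p(ℚ_v) = 1` at the place `v` of `ℚ` above the odd prime `p`**, in Mathlib's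
`v.adicCompletion ℚ` (transport of `padic_pow_eq_one_imp_eq_one` along
`adicCompletion.padicEquiv v : ℚ_v ≃A[ℚ] ℚ_[p]`): the hypothesis `hμ` of the tree's twisted-Kummer
local lemmas at `v ∣ p`. [cite: Cassels1986, Ch. 6] -/
theorem adicCompletion_rat_pow_eq_one_imp_eq_one_above (hp2 : p ≠ 2) (v : HeightOneSpectrum (𝓞 ℚ))
    (hv : (primesEquiv v : ℕ) = p) : ∀ ζ : v.adicCompletion ℚ, ζ ^ p = 1 → ζ = 1 := by
  subst hv
  intro ζ hζ
  have h := padic_pow_eq_one_imp_eq_one hp2 (adicCompletion.padicEquiv v ζ)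
    (by rw [← map_pow, hζ, map_one])
  exact (adicCompletion.padicEquiv v).injective (h.trans (map_one _).symm)

end Summit.BirchSwinnertonDyer.Rank1Residual.X11b.CongruentTransfer

end
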